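import Summits.QuantumFields.YangMills.Theorems.BalabanUVNodesPortS1Series
import Summits.QuantumFields.YangMills.Theorems.BalabanUVNodesK0RecordFormatNamesIntLocalW

/-!
# NODE O port PT-A — SERIES ROWS, `tsum`-NATIVE AND WRAP-AWARE: for the formula `X̂, f ↦ ∑' i, T i X̂ f` itself (no global `HasSum` asked — summability comes from the
# majorant WHERE it is needed), rows (a)∕(b) in DEF-1's all-domains currency (ed.13) and in the OFF-WRAP currency of the wrap-aware residue (ed.13c `AnalyticOnUcOff` ∕ `Bound118OnUcOff`)

Cell `ym-nodeO-ideate`, porter seat `ymgap-nodeO-port-PTA-1` (gen 3); `--supports stmt-QuantumFields-27930` (helper).  [I] = [Balaban1987RG1], [II] = [Balaban1988RG2Cluster],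
[16] = [Balaban1985UVStability3D].  Sequel of `…PortS1Series` (✓p800362), whose `…_of_hasSum` lemmas ask `HasSum` at EVERY `(X̂, f)` — too much for expansions that converge only on the
analyticity domain.  Here the object IS `∑'` (junk `0` where divergent — harmless: (LOC)(GI) hold unconditionally by `isLocal_tsum`∕`isGaugeInv_tsum`, and the rows only read points where the
majorant makes the series converge).
* §1 `piece_tsum` (`rfl`), `summable_piece_of_majorant`, `hasSum_piece_of_majorant`.
* §2 ★ `analyticOnUc_tsum` ∕ ★ `bound118OnUc_tsum` (all domains, ed.13 currency).
* §3 ★ `analyticOnUcOff_tsum` ∕ ★ `bound118OnUcOff_tsum` (off the wrap class, ed.13c currency — the `Ψ` half of `ResidueAtW`).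

HONEST FRAMING.  Plumbing (Weierstrass M-test by name); NO series of Bałaban's is constructed or bounded; the residue is NOT proved; 27930 OPEN; K0⁷ NOT closed; NODE O 0∕1; COUNT 8∕28 ·
K 1∕4 UNMOVED; finite `𝕋⁴_{L^K}` at fixed ε — NOT continuum ∕ OS ∕ Clay; **the Yang–Mills mass gap is NOT proved by any of this.**  No `sorry`, no `def`, no `instance`; standard axioms.
-/

noncomputable section

open scoped BigOperators Matrix.Norms.L2Operator Topology

namespace Summit.QuantumFields.YangMills.Theorems.BalabanUVNodesPortS1

open Summit.QuantumFields.YangMills.Theorems.K0RecordFormatNames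
open Literature.MathematicalPhysics.QuantumFieldTheory.Balaban1983to89
open Literature.MathematicalPhysics.QuantumFieldTheory.Balaban1983to89.Node00
open Literature.MathematicalPhysics.QuantumFieldTheory.Balaban1983to89.T4Continuum (T4Family)
open _root_.Filter

variable {ι : Type*} (F : T4Family)

/-! ## §1  The piece of a `tsum` formula; summability from a majorant -/

/-- The piece of the series formula IS the series of the pieces (`rfl`). [cite: Balaban1987RG1, (1.7) p.261 (bookkeeping)] -/
theorem piece_tsum (T : ι → IntFormula) (Mc k K : ℕ) (X : (recordDomSys F Mc k K).Dom) (φ : Sect2.CPair (F.P K) (MatA 2)) :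
    IntFormula.piece F (fun Xh f => ∑' i, T i Xh f) Mc k K X φ = ∑' i, (T i).piece F Mc k K X φ := rfl

/-- Summability of the pieces at a pair from a summable majorant there. [cite: Balaban1988RG2Cluster, (2.41) p.21 (bookkeeping)] -/
theorem summable_piece_of_majorant (T : ι → IntFormula) (Mc k K : ℕ) (X : (recordDomSys F Mc k K).Dom) (φ : Sect2.CPair (F.P K) (MatA 2))
    (u : ι → ℝ) (hu : Summable u) (hb : ∀ i, ‖(T i).piece F Mc k K X φ‖ ≤ u i) : Summable (fun i => (T i).piece F Mc k K X φ) :=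
  Summable.of_norm_bounded hu hb

/-- The piece of the series formula is the `HasSum`-limit of the pieces wherever a summable majorant holds. [cite: Balaban1988RG2Cluster, (2.41) p.21 (bookkeeping)] -/
theorem hasSum_piece_of_majorant (T : ι → IntFormula) (Mc k K : ℕ) (X : (recordDomSys F Mc k K).Dom) (φ : Sect2.CPair (F.P K) (MatA 2))
    (u : ι → ℝ) (hu : Summable u) (hb : ∀ i, ‖(T i).piece F Mc k K X φ‖ ≤ u i) :
    HasSum (fun i => (T i).piece F Mc k K X φ) (IntFormula.piece F (fun Xh f => ∑' i, T i Xh f) Mc k K X φ) := by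
  rw [piece_tsum]
  exact (summable_piece_of_majorant F T Mc k K X φ u hu hb).hasSum

/-! ## §2  ★ Rows (a)(b) for the `tsum` formula, all domains -/

/-- ★ **ROW (a) FOR THE SERIES FORMULA** (all domains): open sets `O n X ⊇` the record spaces on which every term's piece is holomorphic with a summable uniform majorant ⟹
`AnalyticOnUc` of `∑' i, T i` (Weierstrass M-test, several complex variables). [cite: Balaban1987RG1, p.263 («analytic on the space U^c_j»); Balaban1988RG2Cluster, (2.41) p.21] -/
theorem analyticOnUc_tsum (Mc k : ℕ) (α₀ α₁ : ℝ) (T : ι → IntFormula)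
    (O : (n : ℕ) → (recordDomSys F Mc k (recordK₀ F Mc k + n)).Dom → Set (Sect2.CPair (F.P (recordK₀ F Mc k + n)) (MatA 2)))
    (hO : ∀ n X, IsOpen (O n X))
    (hUcO : ∀ n (X : (recordDomSys F Mc k (recordK₀ F Mc k + n)).Dom) (φ : Sect2.CPair (F.P (recordK₀ F Mc k + n)) (MatA 2)),
      encodeCfg F (recordK₀ F Mc k + n) φ ∈ recordUc F Mc k α₀ α₁ (recordK₀ F Mc k + n) X → φ ∈ O n X)
    (hd : ∀ i n X, DifferentiableOn ℂ (fun φ => (T i).piece F Mc k (recordK₀ F Mc k + n) X φ) (O n X))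
    (u : ι → (n : ℕ) → (recordDomSys F Mc k (recordK₀ F Mc k + n)).Dom → ℝ) (hu : ∀ n X, Summable (fun i => u i n X))
    (hb : ∀ i n X, ∀ φ ∈ O n X, ‖(T i).piece F Mc k (recordK₀ F Mc k + n) X φ‖ ≤ u i n X) :
    IntFormula.AnalyticOnUc F (fun Xh f => ∑' i, T i Xh f) Mc k α₀ α₁ := by
  rw [IntFormula.analyticOnUc_iff]
  intro n X φ hφ
  have hA := Literature.Analysis.Complex.SCV.analyticOnNhd_tsum_of_summable_norm (hO n X) (fun i => hd i n X) (hu n X) (fun i ψ hψ => hb i n X ψ hψ)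
  exact hA φ (hUcO n X φ hφ)

/-- ★ **ROW (b) FOR THE SERIES FORMULA** (all domains): termwise bounds on the record spaces with a majorant series `HasSum (u · n X) (U n X)`, `U n X ≤ E₀e^{−κ d(X)}` ⟹ `Bound118OnUc` of
`∑' i, T i` (comparison of the series with its majorant — no summability hypothesis on the pieces). [cite: Balaban1987RG1, (1.18) p.263; Balaban1985UVStability3D, (23)–(25) p.262; Balaban1988RG2Cluster, (2.41) p.21] -/
theorem bound118OnUc_tsum (Mc k : ℕ) (α₀ α₁ E₀ κ : ℝ) (T : ι → IntFormula)
    (u : ι → (n : ℕ) → (recordDomSys F Mc k (recordK₀ F Mc k + n)).Dom → ℝ)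
    (U : (n : ℕ) → (recordDomSys F Mc k (recordK₀ F Mc k + n)).Dom → ℝ)
    (hb : ∀ i n (X : (recordDomSys F Mc k (recordK₀ F Mc k + n)).Dom) (φ : Sect2.CPair (F.P (recordK₀ F Mc k + n)) (MatA 2)),
      encodeCfg F (recordK₀ F Mc k + n) φ ∈ recordUc F Mc k α₀ α₁ (recordK₀ F Mc k + n) X →
        ‖(T i).piece F Mc k (recordK₀ F Mc k + n) X φ‖ ≤ u i n X)
    (hu : ∀ n X, HasSum (fun i => u i n X) (U n X))
    (hU : ∀ n X, U n X ≤ E₀ * Real.exp (-κ * (recordDomSys F Mc k (recordK₀ F Mc k + n)).dj X)) :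
    IntFormula.Bound118OnUc F (fun Xh f => ∑' i, T i Xh f) Mc k α₀ α₁ E₀ κ := by
  rw [IntFormula.bound118OnUc_iff]
  intro n X φ hφ
  rw [piece_tsum]
  exact (tsum_of_norm_bounded (hu n X) fun i => hb i n X φ hφ).trans (hU n X)

/-! ## §3  ★ Rows (a)(b) for the `tsum` formula OFF the wrap class (the `Ψ` half of `ResidueAtW`) -/

/-- ★ **ROW (a) OFF THE WRAP CLASS** for the series formula (ed.13c `AnalyticOnUcOff`): as §2, the open sets and majorants asked only for `X ∉ recordWrapCtr`.
[cite: Balaban1987RG1, p.263, (1.21) p.264; Balaban1988RG2Cluster, (2.41) p.21] -/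
theorem analyticOnUcOff_tsum (Mc k : ℕ) (α₀ α₁ : ℝ) (T : ι → IntFormula)
    (O : (n : ℕ) → (recordDomSys F Mc k (recordK₀ F Mc k + n)).Dom → Set (Sect2.CPair (F.P (recordK₀ F Mc k + n)) (MatA 2)))
    (hO : ∀ n X, X ∉ recordWrapCtr F Mc k (recordK₀ F Mc k + n) → IsOpen (O n X))
    (hUcO : ∀ n (X : (recordDomSys F Mc k (recordK₀ F Mc k + n)).Dom), X ∉ recordWrapCtr F Mc k (recordK₀ F Mc k + n) →
      ∀ φ : Sect2.CPair (F.P (recordK₀ F Mc k + n)) (MatA 2),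
        encodeCfg F (recordK₀ F Mc k + n) φ ∈ recordUc F Mc k α₀ α₁ (recordK₀ F Mc k + n) X → φ ∈ O n X)
    (hd : ∀ i n X, X ∉ recordWrapCtr F Mc k (recordK₀ F Mc k + n) → DifferentiableOn ℂ (fun φ => (T i).piece F Mc k (recordK₀ F Mc k + n) X φ) (O n X))
    (u : ι → (n : ℕ) → (recordDomSys F Mc k (recordK₀ F Mc k + n)).Dom → ℝ)
    (hu : ∀ n X, X ∉ recordWrapCtr F Mc k (recordK₀ F Mc k + n) → Summable (fun i => u i n X))
    (hb : ∀ i n X, X ∉ recordWrapCtr F Mc k (recordK₀ F Mc k + n) → ∀ φ ∈ O n X, ‖(T i).piece F Mc k (recordK₀ F Mc k + n) X φ‖ ≤ u i n X) :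
    IntFormula.AnalyticOnUcOff F (fun Xh f => ∑' i, T i Xh f) Mc k α₀ α₁ := by
  intro n X hX φ hφ
  have hA := Literature.Analysis.Complex.SCV.analyticOnNhd_tsum_of_summable_norm (hO n X hX) (fun i => hd i n X hX) (hu n X hX)
    (fun i ψ hψ => hb i n X hX ψ hψ)
  have hfun : (fun ψ => IntFormula.piece F (fun Xh f => ∑' i, T i Xh f) Mc k (recordK₀ F Mc k + n) X ψ) =
      fun ψ => ∑' i, (T i).piece F Mc k (recordK₀ F Mc k + n) X ψ := funext fun ψ => piece_tsum F T Mc k _ X ψ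
  rw [hfun]
  exact hA φ (hUcO n X hX φ hφ)

/-- ★ **ROW (b) OFF THE WRAP CLASS** for the series formula (ed.13c `Bound118OnUcOff`). [cite: Balaban1987RG1, (1.18) p.263, (1.21) p.264; Balaban1985UVStability3D, (23)–(25) p.262] -/
theorem bound118OnUcOff_tsum (Mc k : ℕ) (α₀ α₁ E₀ κ : ℝ) (T : ι → IntFormula)
    (u : ι → (n : ℕ) → (recordDomSys F Mc k (recordK₀ F Mc k + n)).Dom → ℝ)
    (U : (n : ℕ) → (recordDomSys F Mc k (recordK₀ F Mc k + n)).Dom → ℝ)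
    (hb : ∀ i n (X : (recordDomSys F Mc k (recordK₀ F Mc k + n)).Dom), X ∉ recordWrapCtr F Mc k (recordK₀ F Mc k + n) →
      ∀ φ : Sect2.CPair (F.P (recordK₀ F Mc k + n)) (MatA 2),
        encodeCfg F (recordK₀ F Mc k + n) φ ∈ recordUc F Mc k α₀ α₁ (recordK₀ F Mc k + n) X →
          ‖(T i).piece F Mc k (recordK₀ F Mc k + n) X φ‖ ≤ u i n X)
    (hu : ∀ n X, X ∉ recordWrapCtr F Mc k (recordK₀ F Mc k + n) → HasSum (fun i => u i n X) (U n X))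
    (hU : ∀ n X, X ∉ recordWrapCtr F Mc k (recordK₀ F Mc k + n) → U n X ≤ E₀ * Real.exp (-κ * (recordDomSys F Mc k (recordK₀ F Mc k + n)).dj X)) :
    IntFormula.Bound118OnUcOff F (fun Xh f => ∑' i, T i Xh f) Mc k α₀ α₁ E₀ κ := by
  intro n X hX φ hφ
  rw [piece_tsum]
  exact (tsum_of_norm_bounded (hu n X hX) fun i => hb i n X hX φ hφ).trans (hU n X hX)

end Summit.QuantumFields.YangMills.Theorems.BalabanUVNodesPortS1

end
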